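import Literature.IUT.HodgeTheaters.StableCurveTemperedDataOfSpecialFibreProp24PrintedOneCall
import Literature.AnabelianGeometry.SemiGraphs.TemperedOpenMapping
import Literature.AnabelianGeometry.SemiGraphs.TemperedResiduallyFiniteTransport
import Literature.AnabelianGeometry.SemiGraphs.TemperedGaloisDomination
import Literature.AnabelianGeometry.SemiGraphs.TemperedSpecialFibreTowerVertexAction
import Literature.AnabelianGeometry.SemiGraphs.TemperedCurveGaloisInfinite
import HarnessLib

/-!
# [IUTchI] Prop. 2.4 (ii) at the genuine 𝔛-datum — residually finite `Π^temp_{X_K}`-quotients above the admissible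
# kernel `admKer_j` are COFINAL (the heart of the residual-finiteness reading (RF)_j, now a theorem)

Mochizuki, *Inter-universal Teichmüller theory I*, kurims manuscript (May 2020), §2, proof of Prop. 2.4 (ii),
p. 51 l. 8–13 "by applying [the evident analogue of] this observation to the quotients
`Π^tp_X ↠ Π^tp_X/Ker(J ↠ Π^tp_{𝔾*_J})`" [cite: Mochizuki2012, Prop 2.4(ii) p.51] (D-0012 claim key; nothing of the
series is asserted here), over Mochizuki, *Semi-graphs of anabelioids*, Publ. RIMS **42** (2006), Ex. 3.10 p. 45
l. 2–4 ("each of the “outer semi-direct product groups” [cf. §0] admits a natural topology with respect to which the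
resulting topological group is tempered" — said there of the `π₁^temp(𝒢_i) ⋊^out Δ_i`), Prop. 3.6 and its
proof pp. 38–39 (the Galois coverings `𝒢_{∞,i} → 𝒢` with `Gal(𝒢_{∞,i}/𝒢)` residually finite — abc-iut-L3's
`galoisDomination_of_prop36`, `exists_le_residuallyFinite_quotient`) and §6 p. 69 (`1 → Δ^temp_X → Π^temp_{X_K} →
G_K → 1`, with abc-iut-L3's open-mapping theorem `isOpenMap_augGK_of_isTempered`)
[cite: MochizukiSemiAnbd2006, Ex 3.10 p.45].  Pages: [IUTchI] = kurims preprint render paper:url-690e7b3c6199;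
[SemiAnbd] = kurims render SemiAnbd-kurims-url-f33ace170ff4 (lit/SOURCES.md §0/§11).

PROOF-ONLY file (abc-iut-L5-t11 gen 8, row «RF-AT-LEVEL-QUOTIENT»; no definition, no instance, no new `Prop` fact;
GAP-LEDGER row G-L5t11g7-3 «(RF)_j»).  In this lineage's closers for [IUTchI] Prop. 2.4 (ii) at the genuine 𝔛-datum
(`prop24ii_ofPiData_of_arithStatementI_canonical_of_RF` p450972, the one-call `prop24_cor25_ofPiData_byName` p451534)
the residual-finiteness reading (RF)_j — "in `Π^tp_j := Π^temp_{X_K} ⧸ admKer_j` the open normal subgroups closed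
for the `Π̂_j`-topology are cofinal" — was a LAW binder.  It is NOT a consequence of temperedness alone (a countable
discrete group that is not residually finite is tempered in the sense of [SemiAnbd] Def. 3.1 (i) and violates the
reading at `U = {1}`), but it IS a consequence of the origin records plus three theorems of the tree, and this file
proves the heart of it, in `Π^temp_{X_K}`:

* § A (group theory): residual finiteness along `≃*`; `G ⧸ N` residually finite iff every `x ∉ N` is excluded by a
  finite-index subgroup above `N`; virtually residually finite quotients are residually finite; § B: `G_K` compact,
  `[Π : N ⊔ Δ^temp_X] = [G_K : aug N] < ∞` for `N` open (open mapping), `N_j ⊴ Π^temp_{X_K}` (`N_char`, `conjDelta_mem_N`);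
* § C `exists_openNormal_rf_quotient_le`: for every open normal `V₀ ⊴ Π^temp_{X_K}` above `admKer_j` there is an open
  normal `N`, `admKer_j ≤ N ≤ V₀`, with `Π^temp_{X_K} ⧸ N` RESIDUALLY FINITE — (1) a residually finite quotient
  `π₁^temp(𝒢_j) ⧸ M` below the image of `V₀ ∩ N_j` (Galois domination at the level chart), pulled back along the
  admissible quotient `adm_j : N_j ↠ π₁^temp(𝒢_j)` (it contains `admKer_j`); (2) its NORMAL CORE `K` in `Π^temp_{X_K}`:
  still above `admKer_j` ((P0)), still a neighbourhood of `1` in `N_j` (every conjugate contains `N'' ∩ N_j` for ONE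
  open normal `N''`), and `N_j ⧸ K` residually finite because `K` is the intersection of ALL conjugates (conjugate the
  separating finite-index subgroup back — no finiteness of the orbit is used); (3) `N := K · (N'' ∩ V₀)`:
  `N_j ∩ N = K` (Dedekind), `N_j N ⧸ N ≅ N_j ⧸ K` (second isomorphism theorem) and `[Π^temp_{X_K} : N_j N] < ∞`
  (`[G_K : aug N] · [Δ^temp_X : N_j]`, via `Π^temp_{X_K} ⧸ N_j`), so `Π^temp_{X_K} ⧸ N` is virtually, hence actually,
  residually finite.
The descent to the level quotient pair and the re-keyed closers WITHOUT the `hRF` binder are in the sequel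
`StableCurveTemperedDataOfSpecialFibreLevelQuotientRFDescent.lean`.  CONDITIONAL on nothing beyond the origin records
(`TemperedCurve`, `GroupLevelData`, `SpecialFibreTower`, (P0)); typed ≠ inhabited; nothing here asserts that abc is
proved or refuted, and nothing here bears on [IUTchIII] Cor. 3.12.
-/
noncomputable section

namespace Literature.IUT.HodgeTheaters

open _root_.Topology
open scoped Pointwise
open Literature.AnabelianGeometry.SemiGraphs Literature.AnabelianGeometry.SemiGraphs.ProfiniteSemiGraph

/-! ### A. Pure group theory: residual finiteness of quotients -/

section GroupTheory

variable {G H : Type*} [Group G] [Group H]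

/-- Residual finiteness is transported along group isomorphisms. [folklore] -/
private theorem residuallyFinite_of_mulEquiv (e : G ≃* H) [hH : Group.ResiduallyFinite H] :
    Group.ResiduallyFinite G := by
  rw [Group.residuallyFinite_iff_exists_finiteIndex] at hH ⊢
  intro g hg
  have hg' : e g ≠ 1 := by
    intro h; exact hg (by simpa using congrArg e.symm h)
  obtain ⟨K, hK, hgK⟩ := hH (e g) hg'
  refine ⟨K.comap e.toMonoidHom, ?_, by simpa using hgK⟩
  rw [Subgroup.finiteIndex_iff] at hK ⊢
  rwa [Subgroup.index_comap_of_surjective _ e.surjective]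

/-- `G ⧸ N` is residually finite as soon as every `x ∉ N` is excluded by a finite-index subgroup of `G`
containing `N`. [folklore] -/
private theorem residuallyFinite_quotient_of_forall_exists (N : Subgroup G) [N.Normal]
    (h : ∀ x : G, x ∉ N → ∃ K : Subgroup G, K.FiniteIndex ∧ N ≤ K ∧ x ∉ K) :
    Group.ResiduallyFinite (G ⧸ N) := by
  rw [Group.residuallyFinite_iff_exists_finiteIndex]
  intro q hq
  induction q using QuotientGroup.induction_on with
  | H x =>
    have hx : x ∉ N := fun hx => hq ((QuotientGroup.eq_one_iff x).mpr hx)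
    obtain ⟨K, hK, hNK, hxK⟩ := h x hx
    refine ⟨K.map (QuotientGroup.mk' N), ?_, ?_⟩
    · rw [Subgroup.finiteIndex_iff] at hK ⊢
      rwa [Subgroup.index_map_eq _ (QuotientGroup.mk'_surjective N) (by rwa [QuotientGroup.ker_mk'])]
    · rintro ⟨k, hk, hkx⟩
      rw [QuotientGroup.mk'_apply, QuotientGroup.eq] at hkx
      exact hxK (by simpa using K.mul_mem hk (hNK hkx))

/-- Conversely, in a residually finite quotient `G ⧸ N` every `x ∉ N` is excluded by a finite-index subgroup
of `G` containing `N`. [folklore] -/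
private theorem exists_finiteIndex_of_residuallyFinite_quotient (N : Subgroup G) [N.Normal]
    [hN : Group.ResiduallyFinite (G ⧸ N)] (x : G) (hx : x ∉ N) :
    ∃ K : Subgroup G, K.FiniteIndex ∧ N ≤ K ∧ x ∉ K := by
  rw [Group.residuallyFinite_iff_exists_finiteIndex] at hN
  have hq : (x : G ⧸ N) ≠ 1 := fun h => hx ((QuotientGroup.eq_one_iff x).mp h)
  obtain ⟨K, hK, hxK⟩ := hN x hq
  refine ⟨K.comap (QuotientGroup.mk' N), ?_, ?_, by simpa using hxK⟩
  · rw [Subgroup.finiteIndex_iff] at hK ⊢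
    rwa [Subgroup.index_comap_of_surjective _ (QuotientGroup.mk'_surjective N)]
  · intro n hn
    rw [Subgroup.mem_comap, QuotientGroup.mk'_apply, (QuotientGroup.eq_one_iff n).mpr hn]
    exact K.one_mem

/-- **Virtually residually finite quotients are residually finite**: if `N ≤ L ≤ G` with `N` normal, `L`
of finite index and `L ⧸ N` residually finite, then `G ⧸ N` is residually finite. [folklore] -/
private theorem residuallyFinite_quotient_of_le (N L : Subgroup G) [N.Normal] (hNL : N ≤ L) [hL : L.FiniteIndex]
    (hrf : Group.ResiduallyFinite (L ⧸ N.subgroupOf L)) : Group.ResiduallyFinite (G ⧸ N) := by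
  apply residuallyFinite_quotient_of_forall_exists
  intro x hx
  by_cases hxL : x ∈ L
  · have hx' : (⟨x, hxL⟩ : L) ∉ N.subgroupOf L := by
      rwa [Subgroup.mem_subgroupOf]
    obtain ⟨K, hK, hNK, hxK⟩ :=
      exists_finiteIndex_of_residuallyFinite_quotient (N.subgroupOf L) ⟨x, hxL⟩ hx'
    refine ⟨K.map L.subtype, ?_, ?_, ?_⟩
    · rw [Subgroup.finiteIndex_iff] at hK ⊢
      rw [Subgroup.index_map_subtype]
      exact mul_ne_zero hK hL.index_ne_zero
    · intro n hn
      exact ⟨⟨n, hNL hn⟩, hNK (by rw [Subgroup.mem_subgroupOf]; exact hn), rfl⟩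
    · rintro ⟨y, hy, hyx⟩
      have : y = ⟨x, hxL⟩ := Subtype.ext hyx
      exact hxK (this ▸ hy)
  · exact ⟨L, hL, hNL, hxL⟩

end GroupTheory

/-! ### B. The genuine datum: finite index of `N ⊔ Δ^temp_X` for open `N`, normality of the levels -/

namespace StableCurveTemperedData

namespace OfSpecialFibre

variable {p : ℕ} [Fact p.Prime] (X : TemperedCurve p)

/-- For `N ≤ Π^temp_{X_K}` open, `N ⊔ Δ^temp_X` has finite index `[G_K : aug(N)]`: `aug` is an open map
(abc-iut-L3's open-mapping theorem `isOpenMap_augGK_of_isTempered`) and `G_K` is compact (`compactSpace_GK`).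
[cite: MochizukiSemiAnbd2006, §6 p.69] -/
theorem finiteIndex_sup_deltaTemp (d : X.GroupLevelData) (N : Subgroup X.PiTemp) (hN : IsOpen (N : Set X.PiTemp)) :
    (N ⊔ X.DeltaTemp).FiniteIndex := by
  haveI := d.secondCountableTopology
  haveI : CompactSpace X.GK := X.compactSpace_GK
  have hopen : IsOpen ((N.map X.augGK.toMonoidHom : Subgroup X.GK) : Set X.GK) := by
    rw [Subgroup.coe_map]
    exact X.isOpenMap_augGK_of_isTempered d.isTempered _ hN
  haveI : Finite (X.GK ⧸ N.map X.augGK.toMonoidHom) := Subgroup.quotient_finite_of_isOpen _ hopen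
  haveI : (N.map X.augGK.toMonoidHom).FiniteIndex := Subgroup.finiteIndex_of_finite_quotient
  have hcomap : (N.map X.augGK.toMonoidHom).comap X.augGK.toMonoidHom = N ⊔ X.DeltaTemp := by
    rw [Subgroup.comap_map_eq, ker_augGK_eq_deltaTemp]
  rw [← hcomap, Subgroup.finiteIndex_iff, Subgroup.index_comap_of_surjective _ X.augGK_surjective]
  exact Subgroup.FiniteIndex.index_ne_zero

/-- The level `N_j ≤ Δ^temp_X`, seen in `Π^temp_{X_K}`, is NORMAL in `Π^temp_{X_K}`: it is characteristic in
`Δ^temp_X` (`N_char`) and `Δ^temp_X ⊴ Π^temp_{X_K}` (abc-iut-L3-t2 `conjDelta_mem_N`).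
[cite: MochizukiSemiAnbd2006, Ex 3.10 p.44] -/
theorem map_N_normal (T : SpecialFibreTower X.DeltaTemp) (j : ℕ) : ((T.N j).map X.DeltaTemp.subtype).Normal := by
  haveI : X.DeltaTemp.Normal := X.normal_deltaTemp
  refine ⟨fun x hx g => ?_⟩
  obtain ⟨n, hn, rfl⟩ := hx
  exact ⟨SpecialFibreTower.conjDelta (Δ := X.DeltaTemp) g n, T.conjDelta_mem_N j g hn, rfl⟩

/-! ### C. The main construction: open normal subgroups of `Π^temp_{X_K}` above `admKer_j` with residually
finite quotient are cofinal -/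

/-- **Cofinality of residually finite Π-quotients above the admissible kernel** (the heart of (RF)_j): for
every OPEN NORMAL `V₀ ⊴ Π^temp_{X_K}` containing `admKer_j` there is an open normal `N ⊴ Π^temp_{X_K}` with
`admKer_j ≤ N ≤ V₀` and `Π^temp_{X_K} ⧸ N` RESIDUALLY FINITE.  Inputs (all theorems over the records):
Galois domination at the level chart `π₁^temp(𝒢_j)` ([SemiAnbd] Prop 3.6, abc-iut-L3
`galoisDomination_of_prop36` + `exists_le_residuallyFinite_quotient`), pulled back along the admissible
quotient `adm_j : N_j ↠ π₁^temp(𝒢_j)`; the NORMAL CORE in `Π^temp_{X_K}` of the resulting open-in-`N_j`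
subgroup (it still contains `N'' ∩ N_j` for one open normal `N''`, and `N_j ⧸ core` is residually finite
because the core is the intersection of ALL conjugates — no finiteness of the orbit is used); the
open-mapping theorem for `Π^temp_{X_K} ↠ G_K` (abc-iut-L3) and `[Δ^temp_X : N_j] < ∞`; (P0) = `hP0`.
([IUTchI] Prop 2.4(ii) p.51 l.8–13; [SemiAnbd] Ex 3.10 p.45 l.1–4) [claim: Mochizuki2012, status: disputed] -/
theorem exists_openNormal_rf_quotient_le (d : X.GroupLevelData) (T : SpecialFibreTower X.DeltaTemp) (j : ℕ) (hP0 : ((T.admKer j).map X.DeltaTemp.subtype).Normal)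
    (V₀ : Subgroup X.PiTemp) [hV₀n : V₀.Normal] (hV₀o : IsOpen (V₀ : Set X.PiTemp))
    (hAV₀ : (T.admKer j).map X.DeltaTemp.subtype ≤ V₀) :
    ∃ N : OpenNormalSubgroup X.PiTemp, (T.admKer j).map X.DeltaTemp.subtype ≤ N.toSubgroup ∧
      N.toSubgroup ≤ V₀ ∧ Group.ResiduallyFinite (X.PiTemp ⧸ N.toSubgroup) := by
  classical
  haveI : X.DeltaTemp.Normal := X.normal_deltaTemp
  -- notation
  set A : Subgroup X.PiTemp := (T.admKer j).map X.DeltaTemp.subtype with hA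
  haveI : A.Normal := hP0
  let ι₂ : ↥(T.N j) →* X.PiTemp := X.DeltaTemp.subtype.comp (T.N j).subtype
  have hι₂_apply : ∀ n : ↥(T.N j), ι₂ n = ((n : X.DeltaTemp) : X.PiTemp) := fun n => rfl
  have hι₂_cont : Continuous ι₂ := continuous_subtype_val.comp continuous_subtype_val
  have hι₂_inj : Function.Injective ι₂ := fun a b h =>
    Subtype.ext (Subtype.ext (by simpa [hι₂_apply] using h))
  have hι₂_ind : Topology.IsInducing ι₂ :=
    Topology.IsInducing.subtypeVal.comp Topology.IsInducing.subtypeVal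
  set Nj : Subgroup X.PiTemp := (T.N j).map X.DeltaTemp.subtype with hNj
  haveI hNjn : Nj.Normal := map_N_normal X T j
  have hNj_range : ι₂.range = Nj := by
    rw [MonoidHom.range_comp, Subgroup.range_subtype]
  -- the admissible quotient of the level
  let adm : ↥(T.N j) →* (T.chart j).G := (T.adm j).toMonoidHom
  have hadm_surj : Function.Surjective adm := T.adm_surjective j
  have hker_adm : ∀ n : ↥(T.N j), n ∈ adm.ker ↔ (n : X.DeltaTemp) ∈ T.admKer j := fun n => by
    show n ∈ (T.adm j).toMonoidHom.ker ↔ _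
    rw [T.ker_adm j, Subgroup.mem_subgroupOf]
  -- Step 1: `V₀ ∩ N_j`, saturated for `admKer_j`, and its image in the chart
  let V₁ : Subgroup ↥(T.N j) := V₀.comap ι₂
  have hV₁o : IsOpen (V₁ : Set ↥(T.N j)) := hV₀o.preimage hι₂_cont
  have hkerV₁ : adm.ker ≤ V₁ := by
    intro n hn
    rw [hker_adm] at hn
    show ι₂ n ∈ V₀
    exact hAV₀ ⟨(n : X.DeltaTemp), hn, rfl⟩
  let W : Subgroup (T.chart j).G := V₁.map adm
  have hWo : IsOpen (W : Set (T.chart j).G) := by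
    rw [Subgroup.coe_map]
    exact (T.isOpenMap_adm j) _ hV₁o
  have hWn : W.Normal := Subgroup.Normal.map inferInstance adm hadm_surj
  let W₀ : OpenNormalSubgroup (T.chart j).G :=
    { toSubgroup := W, isOpen' := hWo, isNormal' := hWn }
  -- Step 2: a residually finite quotient of the chart below `W` (Galois domination, Prop 3.6)
  obtain ⟨M, hMW, hMrf⟩ := ProfiniteSemiGraph.exists_le_residuallyFinite_quotient (T.Gc j) (T.chart j)
    (ProfiniteSemiGraph.galoisDomination_of_prop36 (T.hyp j).toProp36Hypotheses) W₀
  -- Step 3: pull back to `N_j`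
  let φ : ↥(T.N j) →* (T.chart j).G ⧸ M.toSubgroup := (QuotientGroup.mk' M.toSubgroup).comp adm
  have hφ_surj : Function.Surjective φ := (QuotientGroup.mk'_surjective _).comp hadm_surj
  let M₁ : Subgroup ↥(T.N j) := φ.ker
  have hmemM₁ : ∀ n, n ∈ M₁ ↔ adm n ∈ M.toSubgroup := fun n => by
    show n ∈ φ.ker ↔ _
    rw [MonoidHom.mem_ker, MonoidHom.comp_apply, QuotientGroup.mk'_apply, QuotientGroup.eq_one_iff]
  have hM₁rf : Group.ResiduallyFinite (↥(T.N j) ⧸ M₁) :=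
    residuallyFinite_of_mulEquiv (QuotientGroup.quotientKerEquivOfSurjective φ hφ_surj)
  have hM₁o : IsOpen (M₁ : Set ↥(T.N j)) := by
    have : (M₁ : Set ↥(T.N j)) = adm ⁻¹' (M.toSubgroup : Set (T.chart j).G) := by
      ext n; exact hmemM₁ n
    rw [this]
    exact M.isOpen'.preimage (T.adm j).continuous
  have hM₁V₁ : M₁ ≤ V₁ := by
    intro n hn
    have h1 : adm n ∈ W := hMW ((hmemM₁ n).mp hn)
    obtain ⟨v, hv, hvn⟩ := Subgroup.mem_map.mp h1
    have h2 : v⁻¹ * n ∈ adm.ker := by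
      rw [MonoidHom.mem_ker, map_mul, map_inv, hvn, inv_mul_cancel]
    simpa using V₁.mul_mem hv (hkerV₁ h2)
  have hkerM₁ : adm.ker ≤ M₁ := fun n hn =>
    (hmemM₁ n).mpr (by rw [MonoidHom.mem_ker.mp hn]; exact M.toSubgroup.one_mem)
  -- Step 4: push to `Π`
  let M₂ : Subgroup X.PiTemp := M₁.map ι₂
  have hAM₂ : A ≤ M₂ := by
    rintro _ ⟨δ, hδ, rfl⟩
    refine ⟨⟨δ, T.admKer_le j hδ⟩, hkerM₁ ((hker_adm _).mpr hδ), rfl⟩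
  have hM₂V₀ : M₂ ≤ V₀ := Subgroup.map_le_iff_le_comap.mpr hM₁V₁
  have hM₂Nj : M₂ ≤ Nj := by
    rw [← hNj_range]; exact Subgroup.map_le_range ι₂ M₁
  -- an open normal `N''` of `Π` with `N'' ∩ N_j ⊆ M₂`
  obtain ⟨O, hOo, hOpre⟩ := hι₂_ind.isOpen_iff.mp hM₁o
  have h1O : (1 : X.PiTemp) ∈ O := by
    have : (1 : ↥(T.N j)) ∈ ι₂ ⁻¹' O := by rw [hOpre]; exact M₁.one_mem
    simpa using this
  obtain ⟨N'', -, hN''O⟩ := d.isTempered.basis O (hOo.mem_nhds h1O)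
  have hN''Nj : N''.toSubgroup ⊓ Nj ≤ M₂ := by
    rintro x ⟨hxN, hxNj⟩
    rw [← hNj_range] at hxNj
    obtain ⟨n, rfl⟩ := hxNj
    have hn : n ∈ ι₂ ⁻¹' O := hN''O hxN
    rw [hOpre] at hn
    exact ⟨n, hn, rfl⟩
  -- Step 5: the normal core
  let K : Subgroup X.PiTemp := M₂.normalCore
  have hKM₂ : K ≤ M₂ := Subgroup.normalCore_le M₂
  have hAK : A ≤ K := Subgroup.normal_le_normalCore.mpr hAM₂
  have hN''K : N''.toSubgroup ⊓ Nj ≤ K := Subgroup.normal_le_normalCore.mpr hN''Nj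
  -- Step 6: the open normal subgroup `N := K · (N'' ∩ V₀)`
  let N' : Subgroup X.PiTemp := N''.toSubgroup ⊓ V₀
  have hN'o : IsOpen (N' : Set X.PiTemp) := N''.isOpen'.inter hV₀o
  let Nh : Subgroup X.PiTemp := K ⊔ N'
  have hNho : IsOpen (Nh : Set X.PiTemp) := Subgroup.isOpen_mono le_sup_right hN'o
  haveI hNhn : Nh.Normal := inferInstance
  have hANh : A ≤ Nh := hAK.trans le_sup_left
  have hNhV₀ : Nh ≤ V₀ := sup_le (hKM₂.trans hM₂V₀) inf_le_right
  -- Dedekind: `N_j ∩ Nh = K`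
  have hNjNh : ∀ x, x ∈ Nj → x ∈ Nh → x ∈ K := by
    intro x hxNj hxNh
    have hx' : x ∈ ((Nh : Subgroup X.PiTemp) : Set X.PiTemp) := hxNh
    rw [show Nh = K ⊔ N' from rfl, Subgroup.normal_mul] at hx'
    obtain ⟨k, hk, n', hn', rfl⟩ := Set.mem_mul.mp hx'
    have hn'Nj : n' ∈ Nj := by
      simpa using Nj.mul_mem (Nj.inv_mem (hM₂Nj (hKM₂ hk))) hxNj
    have hn'K : n' ∈ K := hN''K ⟨hn'.1, hn'Nj⟩
    exact K.mul_mem hk hn'K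
  -- (i) `N_j ⧸ M₂` is residually finite (it is `N_j ⧸ M₁ ≅ π₁^temp(𝒢_j) ⧸ M`)
  let eR : ↥(T.N j) ≃* ↥Nj := (MonoidHom.ofInjective hι₂_inj).trans (MulEquiv.subgroupCongr hNj_range)
  have heR : ∀ n : ↥(T.N j), ((eR n : ↥Nj) : X.PiTemp) = ι₂ n := fun n => rfl
  have he : M₁.map (eR : ↥(T.N j) →* ↥Nj) = M₂.subgroupOf Nj := by
    ext y
    constructor
    · rintro ⟨m, hm, rfl⟩
      rw [Subgroup.mem_subgroupOf]
      exact ⟨m, hm, (heR m).symm⟩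
    · intro hy
      rw [Subgroup.mem_subgroupOf] at hy
      obtain ⟨m, hm, hmy⟩ := hy
      refine ⟨m, hm, Subtype.ext ?_⟩
      rw [← hmy]; exact heR m
  haveI hM₂n : (M₂.subgroupOf Nj).Normal := by
    rw [← he]; exact Subgroup.Normal.map inferInstance _ eR.surjective
  haveI hM₂rf : Group.ResiduallyFinite (↥Nj ⧸ M₂.subgroupOf Nj) :=
    residuallyFinite_of_mulEquiv (QuotientGroup.congr M₁ (M₂.subgroupOf Nj) eR he).symm
  -- (ii) `N_j ⧸ (N_j ∩ N) = N_j ⧸ K` is residually finite: `K` is the intersection of ALL conjugates of `M₂`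
  have hNjrf : Group.ResiduallyFinite (↥Nj ⧸ Nh.subgroupOf Nj) := by
    apply residuallyFinite_quotient_of_forall_exists
    intro y hy
    rw [Subgroup.mem_subgroupOf] at hy
    have hyK : (y : X.PiTemp) ∉ K := fun h => hy (le_sup_left (a := K) (b := N') h)
    have hyK' : ¬ ∀ b : X.PiTemp, b * y * b⁻¹ ∈ M₂ := hyK
    obtain ⟨b, hb⟩ := not_forall.mp hyK'
    let z : ↥Nj := ⟨b * y * b⁻¹, hNjn.conj_mem _ y.2 b⟩
    have hz : z ∉ M₂.subgroupOf Nj := by rw [Subgroup.mem_subgroupOf]; exact hb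
    obtain ⟨K₂, hK₂, hMK₂, hzK₂⟩ := exists_finiteIndex_of_residuallyFinite_quotient (M₂.subgroupOf Nj) z hz
    refine ⟨K₂.comap (MulAut.conjNormal b : MulAut ↥Nj).toMonoidHom, ?_, ?_, ?_⟩
    · rw [Subgroup.finiteIndex_iff] at hK₂ ⊢
      have hsurj : Function.Surjective ((MulAut.conjNormal b : MulAut ↥Nj).toMonoidHom) :=
        (MulAut.conjNormal b : MulAut ↥Nj).surjective
      rwa [Subgroup.index_comap_of_surjective _ hsurj]
    · intro w hw
      rw [Subgroup.mem_subgroupOf] at hw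
      have hwK : (w : X.PiTemp) ∈ K := hNjNh w w.2 hw
      have hbw : b * w * b⁻¹ ∈ K := (Subgroup.normalCore_normal M₂).conj_mem _ hwK b
      rw [Subgroup.mem_comap]
      apply hMK₂
      rw [Subgroup.mem_subgroupOf]
      show ((MulAut.conjNormal b w : ↥Nj) : X.PiTemp) ∈ M₂
      rw [MulAut.conjNormal_apply]
      exact hKM₂ hbw
    · intro hyc
      rw [Subgroup.mem_comap] at hyc
      apply hzK₂
      have : (MulAut.conjNormal b : MulAut ↥Nj).toMonoidHom y = z :=
        Subtype.ext (MulAut.conjNormal_apply b y)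
      rwa [this] at hyc
  -- (iii) `L := N_j · N` has finite index `[G_K : aug N] · [Δ : N_j]`-ish, and `L ⧸ N ≅ N_j ⧸ K`
  have hNjD : Nj ≤ X.DeltaTemp := Subgroup.map_subtype_le _
  haveI hLfi : (Nj ⊔ Nh).FiniteIndex := by
    let g : X.PiTemp →* X.PiTemp ⧸ Nj := QuotientGroup.mk' Nj
    have hg : Function.Surjective g := QuotientGroup.mk'_surjective Nj
    have hker : g.ker = Nj := QuotientGroup.ker_mk' Nj
    have h1 : ((Nj ⊔ Nh).map g).index = (Nj ⊔ Nh).index :=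
      Subgroup.index_map_eq _ hg (by rw [hker]; exact le_sup_left)
    have h2 : (Nj ⊔ Nh).map g = Nh.map g := by
      rw [Subgroup.map_sup, QuotientGroup.map_mk'_self, bot_sup_eq]
    haveI : (Nh.map g).Normal := Subgroup.Normal.map hNhn g hg
    have h3 : (Nh.map g ⊔ X.DeltaTemp.map g).index = (Nh ⊔ X.DeltaTemp).index := by
      rw [← Subgroup.map_sup]
      exact Subgroup.index_map_eq _ hg (by rw [hker]; exact le_sup_of_le_right hNjD)
    have h4 : (Nh.map g).relIndex (Nh.map g ⊔ X.DeltaTemp.map g) = (Nh.map g).relIndex (X.DeltaTemp.map g) :=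
      Subgroup.relIndex_sup_left (X.DeltaTemp.map g) (Nh.map g)
    -- `Δ ⧸ N_j` is finite, hence so is the image of `Δ` in `Π ⧸ N_j`
    haveI : (Nj.subgroupOf X.DeltaTemp).FiniteIndex := by
      have hsub : Nj.subgroupOf X.DeltaTemp = T.N j := by
        change ((T.N j).map X.DeltaTemp.subtype).comap X.DeltaTemp.subtype = T.N j
        exact Subgroup.comap_map_eq_self_of_injective (Subgroup.subtype_injective X.DeltaTemp) (T.N j)
      rw [hsub]
      exact T.N_finiteIndex j
    haveI : Finite ↥(X.DeltaTemp.map g) := by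
      have hkr : (g.restrict X.DeltaTemp).ker = Nj.subgroupOf X.DeltaTemp := by
        rw [MonoidHom.ker_restrict, hker]
      haveI : Finite (↥X.DeltaTemp ⧸ (g.restrict X.DeltaTemp).ker) := by
        rw [hkr]; exact Subgroup.finite_quotient_of_finiteIndex
      have hfin : Finite ↥(g.restrict X.DeltaTemp).range :=
        Finite.of_equiv _ (QuotientGroup.quotientKerEquivRange (g.restrict X.DeltaTemp)).toEquiv
      rwa [MonoidHom.restrict_range] at hfin
    have h5 : (Nh.map g).relIndex (X.DeltaTemp.map g) ≠ 0 := Subgroup.index_ne_zero_of_finite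
    haveI h6 : (Nh ⊔ X.DeltaTemp).FiniteIndex := finiteIndex_sup_deltaTemp X d Nh hNho
    rw [Subgroup.finiteIndex_iff, ← h1, h2,
      ← Subgroup.relIndex_mul_index (le_sup_left : Nh.map g ≤ Nh.map g ⊔ X.DeltaTemp.map g), h4, h3]
    exact mul_ne_zero h5 h6.index_ne_zero
  have hLrf : Group.ResiduallyFinite (↥(Nj ⊔ Nh) ⧸ Nh.subgroupOf (Nj ⊔ Nh)) :=
    haveI := hNjrf
    residuallyFinite_of_mulEquiv (QuotientGroup.quotientInfEquivProdNormalQuotient Nj Nh).symm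
  have hrf : Group.ResiduallyFinite (X.PiTemp ⧸ Nh) :=
    residuallyFinite_quotient_of_le Nh (Nj ⊔ Nh) le_sup_right hLrf
  exact ⟨{ toSubgroup := Nh, isOpen' := hNho, isNormal' := hNhn }, hANh, hNhV₀, hrf⟩

end OfSpecialFibre
end StableCurveTemperedData
end Literature.IUT.HodgeTheaters

end
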